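import Mathlib.NumberTheory.LSeries.RiemannZeta
import Mathlib.NumberTheory.EulerProduct.Basic
import Mathlib.Analysis.Normed.Group.Tannery
import Mathlib.Analysis.SpecialFunctions.Pow.Deriv
import Literature.NumberTheory.Sieve.AsymptoticSieveForPrimesLogSums
import Literature.NumberTheory.Sieve.AsymptoticSieveForPrimesDecompositionProofs
import Literature.NumberTheory.Sieve.AsymptoticSieveForPrimesReduction
import HarnessLib

/-!
# Asymptotic sieve for primes: FI (1.13)–(1.14) from (2.4) (proof)

Friedlander–Iwaniec, *Asymptotic sieve for primes*, Ann. of Math. 148 (1998), p. 1043: "The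
hypothesis (1.9) allows us (see (2.4)) to extend (1.10) to the complete series (1.12),
`H = -∑_d μ(d) g(d) log d` (1.13) … That this is positive follows since the series is also given by
the infinite product (1.14), `H = ∏_p (1 - g(p))(1 - 1/p)⁻¹`."  In this tree the two displays are
the named facts `fi_moebius_density_log_sum` ((1.12)–(1.14): the log-weighted Möbius–density sums
converge to `-H`, `H` being the limit of the partial products (1.14)) and
`fi_moebius_density_cancellation` ((2.4): `∑_{d ≤ y, (d,ν)=1} μ(d) g(d) ≪ σ_ν (log y)^{-6}`), both in
`Literature/NumberTheory/Sieve/AsymptoticSieveForPrimesInputs.lean`.  This file proves the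
implication the paper asserts in passing:

* `fi_moebius_density_log_sum_of_cancellation :
    fi_moebius_density_cancellation → fi_moebius_density_log_sum`.

## The argument

Write `c(d) = μ(d) g(d)` and `C(N) = ∑_{d ≤ N} c(d)`, so that (2.4) with `ν = 1` gives
`|C(N)| ≤ K (log N)^{-6}`.

1. *Abel summation* (`tendsto_sum_mul_log_of_partial_bound`, from `sum_Icc_mul_log_eq` of
   `…LogSums`): `∑_{b ≤ N} c(b) log b = C(N) log(N+1) - ∑_{d ≤ N} C(d) log((d+1)/d) → -W`,
   `W := ∑_d C(d) log((d+1)/d)` (absolutely convergent: `log((d+1)/d) (log d)^{-6} ≤ 2^6 u_d` with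
   `u_d = (log d)^{-5} - (log(d+1))^{-5}` telescoping, `sub_div_pow_six_le`).
2. *The Dirichlet series at `s → 0+`* (`tendsto_tsum_partial_mul_rpow_diff_div`): for `s > 0`,
   `Φ(s) := ∑_d c(d) d^{-s} = ∑_d C(d) (d^{-s} - (d+1)^{-s})` (Abel, `tsum_mul_rpow_neg_eq_tsum_partial`)
   and `0 ≤ d^{-s} - (d+1)^{-s} ≤ s log((d+1)/d)`, `(d^{-s} - (d+1)^{-s})/s → log((d+1)/d)`, so by
   dominated convergence (Tannery) `Φ(s)/s → W`.
3. *Euler products* (`summable_and_tendsto_prod_moebius_density_rpow`, `tendsto_prod_one_sub_rpow_inv`,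
   `tsum_moebius_density_rpow_mul_zeta_eq_exp`): for `s > 0` the series `Φ(s)` and `ζ(1+s) = ∑ n^{-1-s}`
   converge absolutely and have Euler products (Mathlib's `EulerProduct.eulerProduct`), whence
   `Φ(s) ζ(1+s) = exp(∑_p e_p(s))`, `e_p(s) = log(1 - g(p)p^{-s}) - log(1 - p^{-1-s})`.
4. *The limit of the exponent* (`tendsto_tsum_log_euler_factors`): `e_p(s) = a_p p^{-s} + b_p(s)` with
   `a_p = 1/p - g(p) = O(1/p)` and `|b_p(s)| ≤ C_b p^{-2}` uniformly in `s ≥ 0`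
   (`exists_bound_log_euler_factors`, from `|log(1-u) + u| ≤ u²/(1-u)`).  The `b`-part is continuous at
   `0+` (Tannery again); since the partial products (1.14) tend to `H > 0`
   (`fi_densityConstant_pos_holds`), `∑_{p ≤ N} a_p = log P_N - ∑_{p ≤ N} b_p(0)` converges, and Abel's
   limit theorem for Dirichlet series with coefficients `O(1/n)`
   (`tendsto_tsum_mul_rpow_neg_of_tendsto_sum`) gives `∑_p a_p p^{-s} → lim ∑_{p ≤ N} a_p`.  Adding up,
   `∑_p e_p(s) → log H`.
5. *Conclusion*: `s ζ(1+s) → 1` (`tendsto_mul_tsum_rpow_neg`, from Mathlib's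
   `tendsto_sub_mul_tsum_nat_rpow`), so `Φ(s)/s = Φ(s)ζ(1+s) / (sζ(1+s)) → H`; by uniqueness of limits
   `W = H`, i.e. `∑_{b ≤ N} μ(b) g(b) log b → -H`.

(FI do not spell this argument out — p. 1043 only says "see (2.4)"; the route through
`Φ(s)ζ(1+s)` used here is a standard Abelian/Euler-product argument. [folklore])

## Main statements

* `tendsto_sum_mul_log_of_partial_bound`, `tendsto_tsum_partial_mul_rpow_diff_div`,
  `tendsto_tsum_mul_rpow_neg_of_tendsto_sum` (Abelian lemmas, [folklore]);
* `summable_and_tendsto_prod_moebius_density_rpow`, `tsum_moebius_density_rpow_mul_zeta_eq_exp`,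
  `tendsto_tsum_log_euler_factors` (the Euler product side);
* `fi_moebius_density_log_sum_of_cancellation` (the implication (2.4) ⟹ (1.13)).

## References

* [FriedlanderIwaniecASP1998] J. Friedlander, H. Iwaniec, *Asymptotic sieve for primes*, Ann. of
  Math. (2) 148 (1998), 1041–1065, (1.12)–(1.14), (2.4). doi:10.2307/121035
-/

noncomputable section

open Filter Finset Topology
open scoped ArithmeticFunction.Moebius ArithmeticFunction.zeta

namespace Literature.NumberTheory.Sieve

/-! ### Discrete Abel summation and the telescoping majorant -/

/-- **Abel summation with partial sums**: `∑_{n ≤ N} c(n) φ(n) = ∑_{n ≤ N} C(n)(φ(n) - φ(n+1)) +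
C(N)φ(N+1)` with `C(n) = ∑_{d ≤ n} c(d)`. [folklore] -/
theorem sum_Icc_mul_eq_sum_partial (c φ : ℕ → ℝ) (N : ℕ) :
    ∑ n ∈ Icc 1 N, c n * φ n =
      ∑ n ∈ Icc 1 N, (∑ d ∈ Icc 1 n, c d) * (φ n - φ (n + 1)) +
        (∑ d ∈ Icc 1 N, c d) * φ (N + 1) := by
  induction N with
  | zero => simp
  | succ N ih =>
    rw [Finset.sum_Icc_succ_top (by omega), Finset.sum_Icc_succ_top (by omega), ih,
      Finset.sum_Icc_succ_top (show 1 ≤ N + 1 by omega) c]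
    ring

/-- `log(d+1) ≤ 2 log d` for `d ≥ 2` (`d + 1 ≤ d²`). [folklore] -/
theorem log_succ_le_two_mul_log {d : ℕ} (hd : 2 ≤ d) :
    Real.log ((d : ℝ) + 1) ≤ 2 * Real.log d := by
  have hd2 : (2 : ℝ) ≤ d := by exact_mod_cast hd
  rw [← Real.log_rpow (by linarith), show (2 : ℝ) = ((2 : ℕ) : ℝ) by norm_num, Real.rpow_natCast]
  refine Real.log_le_log (by linarith) ?_
  nlinarith

/-- **Summability of the telescoping majorant**: if `|C(d)| ≤ K (log d)^{-6}` for `d ≥ 2` then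
`d ↦ |C(d)| (log(d+1) - log d)` is summable: for `d ≥ 2` the term is at most
`(64K/5)((log d)^{-5} - (log(d+1))^{-5})` (`(log(d+1))⁶ ≤ 64 (log d)⁶`, `sub_div_pow_six_le`).
[folklore] -/
theorem summable_abs_mul_log_succ_sub_log {C : ℕ → ℝ} {K : ℝ} (hK : 0 ≤ K)
    (hC : ∀ d : ℕ, 2 ≤ d → |C d| ≤ K / Real.log d ^ 6) :
    Summable fun d : ℕ => |C d| * (Real.log ((d : ℝ) + 1) - Real.log d) := by
  set t : ℕ → ℝ := fun d => |C d| * (Real.log ((d : ℝ) + 1) - Real.log d) with ht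
  set a : ℕ → ℝ := fun d => (Real.log (d : ℝ) ^ 5)⁻¹ with ha
  have ht0 : ∀ d : ℕ, 0 ≤ t d := by
    intro d
    rcases Nat.eq_zero_or_pos d with rfl | hd
    · simp [ht]
    · exact mul_nonneg (abs_nonneg _)
        (sub_nonneg.mpr (Real.log_le_log (by exact_mod_cast hd) (by linarith)))
  have hterm : ∀ d : ℕ, 2 ≤ d → t d ≤ 64 * K / 5 * (a d - a (d + 1)) := by
    intro d hd
    have hd2 : (2 : ℝ) ≤ d := by exact_mod_cast hd
    have hld : 0 < Real.log d := Real.log_pos (by linarith)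
    have hle : Real.log (d : ℝ) ≤ Real.log ((d : ℝ) + 1) :=
      Real.log_le_log (by linarith) (by linarith)
    have hsub := sub_div_pow_six_le hld hle
    have h2 := log_succ_le_two_mul_log hd
    have hv0 : 0 < Real.log ((d : ℝ) + 1) := hld.trans_le hle
    have h64 : Real.log ((d : ℝ) + 1) ^ 6 ≤ 64 * Real.log d ^ 6 := by
      calc Real.log ((d : ℝ) + 1) ^ 6 ≤ (2 * Real.log d) ^ 6 := pow_le_pow_left₀ hv0.le h2 6
        _ = 64 * Real.log d ^ 6 := by ring
    have hdiff0 : 0 ≤ Real.log ((d : ℝ) + 1) - Real.log d := sub_nonneg.mpr hle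
    calc t d ≤ K / Real.log d ^ 6 * (Real.log ((d : ℝ) + 1) - Real.log d) :=
          mul_le_mul_of_nonneg_right (hC d hd) hdiff0
      _ = 64 * K * ((Real.log ((d : ℝ) + 1) - Real.log d) / (64 * Real.log d ^ 6)) := by
          field_simp
      _ ≤ 64 * K * ((Real.log ((d : ℝ) + 1) - Real.log d) / Real.log ((d : ℝ) + 1) ^ 6) := by
          refine mul_le_mul_of_nonneg_left ?_ (by positivity)
          exact div_le_div_of_nonneg_left hdiff0 (pow_pos hv0 6) h64
      _ ≤ 64 * K * (((Real.log (d : ℝ) ^ 5)⁻¹ - (Real.log ((d : ℝ) + 1) ^ 5)⁻¹) / 5) :=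
          mul_le_mul_of_nonneg_left hsub (by positivity)
      _ = 64 * K / 5 * (a d - a (d + 1)) := by rw [ha]; push_cast; ring
  -- bounded partial sums of the shifted sequence `d ↦ t (d + 2)`
  have hshift : Summable fun d : ℕ => t (d + 2) := by
    refine summable_of_sum_range_le (c := 64 * K / 5 * a 2) (fun d => ht0 _) fun n => ?_
    have htel : ∑ d ∈ Finset.range n, (a (d + 2) - a (d + 2 + 1)) = a 2 - a (n + 2) := by
      induction n with
      | zero => simp
      | succ n ih => rw [Finset.sum_range_succ, ih]; ring_nf
    have ha0 : 0 ≤ a (n + 2) := by rw [ha]; positivity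
    calc ∑ d ∈ Finset.range n, t (d + 2) ≤ ∑ d ∈ Finset.range n, 64 * K / 5 * (a (d + 2) - a (d + 2 + 1)) :=
          Finset.sum_le_sum fun d _ => hterm (d + 2) (by omega)
      _ = 64 * K / 5 * (a 2 - a (n + 2)) := by rw [← Finset.mul_sum, htel]
      _ ≤ 64 * K / 5 * a 2 := by nlinarith
  exact (summable_nat_add_iff 2).mp hshift

/-! ### The weights `d^{-s} - (d+1)^{-s}` -/

/-- For `d ≥ 1`, `s ≥ 0`: `0 ≤ d^{-s} - (d+1)^{-s} ≤ s (log(d+1) - log d)`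
(`(d+1)^{-s} = d^{-s} e^{-s(log(d+1) - log d)}`, `1 - e^{-x} ≤ x`, `d^{-s} ≤ 1`). [folklore] -/
theorem rpow_neg_sub_rpow_neg_bounds {d : ℕ} (hd : 1 ≤ d) {s : ℝ} (hs : 0 ≤ s) :
    0 ≤ (d : ℝ) ^ (-s) - ((d : ℝ) + 1) ^ (-s) ∧
      (d : ℝ) ^ (-s) - ((d : ℝ) + 1) ^ (-s) ≤ s * (Real.log ((d : ℝ) + 1) - Real.log d) := by
  have hd0 : (0 : ℝ) < d := by exact_mod_cast hd
  have hd1 : (1 : ℝ) ≤ d := by exact_mod_cast hd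
  set L := Real.log ((d : ℝ) + 1) - Real.log d with hL
  have hL0 : 0 ≤ L := sub_nonneg.mpr (Real.log_le_log hd0 (by linarith))
  have hkey : ((d : ℝ) + 1) ^ (-s) = (d : ℝ) ^ (-s) * Real.exp (-(s * L)) := by
    rw [Real.rpow_def_of_pos (by linarith), Real.rpow_def_of_pos hd0, ← Real.exp_add]
    congr 1
    rw [hL]; ring
  have hds : (d : ℝ) ^ (-s) ≤ 1 := Real.rpow_le_one_of_one_le_of_nonpos hd1 (by linarith)
  have hds0 : 0 < (d : ℝ) ^ (-s) := Real.rpow_pos_of_pos hd0 _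
  rw [hkey]
  have hexp1 : Real.exp (-(s * L)) ≤ 1 := by
    rw [Real.exp_le_one_iff]; nlinarith
  constructor
  · nlinarith
  · have h1 : 1 - s * L ≤ Real.exp (-(s * L)) := by
      have := Real.add_one_le_exp (-(s * L)); linarith
    have h2 : (d : ℝ) ^ (-s) * (1 - Real.exp (-(s * L))) ≤ 1 * (s * L) :=
      mul_le_mul hds (by linarith) (by linarith) zero_le_one
    nlinarith

/-- For `d ≥ 1`: `(d^{-s} - (d+1)^{-s})/s → log(d+1) - log d` as `s → 0⁺` (the derivative at `0`).
[folklore] -/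
theorem tendsto_rpow_neg_sub_div {d : ℕ} (hd : 1 ≤ d) :
    Tendsto (fun s : ℝ => ((d : ℝ) ^ (-s) - ((d : ℝ) + 1) ^ (-s)) / s) (𝓝[>] 0)
      (𝓝 (Real.log ((d : ℝ) + 1) - Real.log d)) := by
  have hd0 : (0 : ℝ) < d := by exact_mod_cast hd
  have hd1 : (0 : ℝ) < (d : ℝ) + 1 := by linarith
  -- `G(s) = d^{-s} - (d+1)^{-s} = (1/d)^s - (1/(d+1))^s`, `G(0) = 0`, `G'(0) = log(d+1) - log d`
  have h1 : HasDerivAt (fun s : ℝ => (d : ℝ)⁻¹ ^ s) (-(Real.log d)) 0 := by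
    have h := (Real.hasStrictDerivAt_const_rpow (inv_pos.mpr hd0) (0 : ℝ)).hasDerivAt
    rwa [Real.rpow_zero, one_mul, Real.log_inv] at h
  have h2 : HasDerivAt (fun s : ℝ => ((d : ℝ) + 1)⁻¹ ^ s) (-(Real.log ((d : ℝ) + 1))) 0 := by
    have h := (Real.hasStrictDerivAt_const_rpow (inv_pos.mpr hd1) (0 : ℝ)).hasDerivAt
    rwa [Real.rpow_zero, one_mul, Real.log_inv] at h
  have hG := h1.sub h2
  have hslope := hG.tendsto_slope_zero_right
  refine (hslope.congr' ?_).trans ?_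
  · filter_upwards [self_mem_nhdsWithin] with s _
    simp only [zero_add, Pi.sub_apply, Real.rpow_zero, sub_self, sub_zero, smul_eq_mul]
    rw [inv_mul_eq_div, Real.inv_rpow hd0.le, Real.inv_rpow hd1.le, Real.rpow_neg hd0.le,
      Real.rpow_neg hd1.le]
  · rw [show -(Real.log d) - -(Real.log ((d : ℝ) + 1)) = Real.log ((d : ℝ) + 1) - Real.log d by ring]

/-- **Tannery for the Abel-transformed Dirichlet series**: if `|C(d)| ≤ K(log d)^{-6}` (`d ≥ 2`),
then `∑_d C(d)(d^{-s} - (d+1)^{-s})/s → ∑_d C(d)(log(d+1) - log d)` as `s → 0⁺`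
(domination by `|C(d)|(log(d+1) - log d)`, `summable_abs_mul_log_succ_sub_log`). [folklore] -/
theorem tendsto_tsum_partial_mul_rpow_diff_div {C : ℕ → ℝ} (hC0 : C 0 = 0) {K : ℝ} (hK : 0 ≤ K)
    (hC : ∀ d : ℕ, 2 ≤ d → |C d| ≤ K / Real.log d ^ 6) :
    Tendsto (fun s : ℝ => ∑' d : ℕ, C d * (((d : ℝ) ^ (-s) - ((d : ℝ) + 1) ^ (-s)) / s)) (𝓝[>] 0)
      (𝓝 (∑' d : ℕ, C d * (Real.log ((d : ℝ) + 1) - Real.log d))) := by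
  refine tendsto_tsum_of_dominated_convergence (summable_abs_mul_log_succ_sub_log hK hC)
    (fun d => ?_) ?_
  · rcases Nat.eq_zero_or_pos d with rfl | hd
    · simp only [hC0, zero_mul]; exact tendsto_const_nhds
    · exact (tendsto_rpow_neg_sub_div hd).const_mul _
  · filter_upwards [self_mem_nhdsWithin] with s hs d
    have hs0 : 0 < s := hs
    rcases Nat.eq_zero_or_pos d with rfl | hd
    · simp [hC0]
    · rw [Real.norm_eq_abs, abs_mul]
      refine mul_le_mul_of_nonneg_left ?_ (abs_nonneg _)
      obtain ⟨h0, h1⟩ := rpow_neg_sub_rpow_neg_bounds hd hs0.le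
      rw [abs_of_nonneg (div_nonneg h0 hs0.le), div_le_iff₀ hs0]
      linarith

/-! ### The logarithmic sum converges -/

/-- `∑_{n < N+1} f(n) = ∑_{1 ≤ n ≤ N} f(n)` when `f(0) = 0`. [folklore] -/
theorem sum_range_succ_eq_sum_Icc_of_zero (f : ℕ → ℝ) (hf : f 0 = 0) (N : ℕ) :
    ∑ n ∈ Finset.range (N + 1), f n = ∑ n ∈ Icc 1 N, f n := by
  induction N with
  | zero => simp [hf]
  | succ N ih => rw [Finset.sum_range_succ, ih, Finset.sum_Icc_succ_top (by omega)]

/-- `K (log N)^{-k} → 0` along the naturals (`k ≥ 1`). [folklore] -/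
theorem tendsto_const_div_log_pow_atTop (K : ℝ) {k : ℕ} (hk : 1 ≤ k) :
    Tendsto (fun N : ℕ => K / Real.log N ^ k) atTop (𝓝 0) := by
  have h : Tendsto (fun N : ℕ => Real.log N ^ k) atTop atTop :=
    (tendsto_pow_atTop (by omega)).comp (Real.tendsto_log_atTop.comp tendsto_natCast_atTop_atTop)
  exact tendsto_const_nhds.div_atTop h

/-- **`∑_{b ≤ N} c(b) log b → -∑_d C(d)(log(d+1) - log d)`** when `|C(d)| ≤ K (log d)^{-6}`
(`d ≥ 2`), by Abel summation (`sum_Icc_mul_eq_sum_partial` with `φ = log`; the boundary term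
`C(N) log(N+1) ≤ 2K (log N)^{-5} → 0`). [folklore] -/
theorem tendsto_sum_mul_log_of_partial_bound {c : ℕ → ℝ} {K : ℝ} (hK : 0 ≤ K)
    (hC : ∀ d : ℕ, 2 ≤ d → |∑ j ∈ Icc 1 d, c j| ≤ K / Real.log d ^ 6) :
    Tendsto (fun N : ℕ => ∑ b ∈ Icc 1 N, c b * Real.log b) atTop
      (𝓝 (-∑' d : ℕ, (∑ j ∈ Icc 1 d, c j) * (Real.log ((d : ℝ) + 1) - Real.log d))) := by
  set C : ℕ → ℝ := fun d => ∑ j ∈ Icc 1 d, c j with hCdef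
  have hC0 : C 0 = 0 := by simp [hCdef]
  have hsumm : Summable fun d : ℕ => C d * (Real.log ((d : ℝ) + 1) - Real.log d) := by
    refine Summable.of_norm ?_
    have h := summable_abs_mul_log_succ_sub_log hK hC
    refine h.congr fun d => ?_
    rw [Real.norm_eq_abs, abs_mul]
    rcases Nat.eq_zero_or_pos d with rfl | hd
    · simp [hC0]
    · rw [abs_of_nonneg (sub_nonneg.mpr (Real.log_le_log (by exact_mod_cast hd) (by linarith)))]
  -- Abel summation
  have hAbel : ∀ N : ℕ, ∑ b ∈ Icc 1 N, c b * Real.log b =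
      -(∑ n ∈ Icc 1 N, C n * (Real.log ((n : ℝ) + 1) - Real.log n)) + C N * Real.log ((N : ℝ) + 1) := by
    intro N
    rw [sum_Icc_mul_eq_sum_partial c (fun n => Real.log n) N, ← Finset.sum_neg_distrib]
    push_cast
    congr 1
    refine Finset.sum_congr rfl fun n _ => ?_
    ring
  simp_rw [hAbel]
  rw [show -∑' d : ℕ, C d * (Real.log ((d : ℝ) + 1) - Real.log d) =
    -∑' d : ℕ, C d * (Real.log ((d : ℝ) + 1) - Real.log d) + 0 by ring]
  refine Tendsto.add (Tendsto.neg ?_) ?_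
  · have h := (hsumm.hasSum.tendsto_sum_nat).comp (tendsto_add_atTop_nat 1)
    refine h.congr fun N => ?_
    simp only [Function.comp_def]
    exact sum_range_succ_eq_sum_Icc_of_zero _ (by simp [hC0]) N
  · -- the boundary term
    refine squeeze_zero_norm' ?_ (tendsto_const_div_log_pow_atTop (2 * K) (k := 5) (by norm_num))
    filter_upwards [eventually_ge_atTop 2] with N hN
    have hN2 : (2 : ℝ) ≤ N := by exact_mod_cast hN
    have hlN : 0 < Real.log N := Real.log_pos (by linarith)
    rw [Real.norm_eq_abs, abs_mul, abs_of_nonneg (Real.log_nonneg (by linarith))]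
    calc |C N| * Real.log ((N : ℝ) + 1) ≤ K / Real.log N ^ 6 * (2 * Real.log N) :=
          mul_le_mul (hC N hN) (log_succ_le_two_mul_log hN) (Real.log_nonneg (by linarith))
            (by positivity)
      _ = 2 * K / Real.log N ^ 5 := by field_simp

/-! ### An Abelian theorem for Dirichlet series with convergent coefficient sum -/

/-- For `s > 0` and `n ≥ 1`: `(n+1)^{-s} → 0` is not needed; what we use is the telescoping sum
`∑_{1 ≤ n ≤ N} (n^{-s} - (n+1)^{-s}) = 1 - (N+1)^{-s}`. [folklore] -/
theorem sum_Icc_rpow_neg_sub (s : ℝ) (N : ℕ) :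
    ∑ n ∈ Icc 1 N, ((n : ℝ) ^ (-s) - ((n : ℝ) + 1) ^ (-s)) = 1 - ((N : ℝ) + 1) ^ (-s) := by
  induction N with
  | zero => simp
  | succ N ih =>
    rw [Finset.sum_Icc_succ_top (by omega), ih]
    push_cast
    ring

/-- For `s > 0`, the weights `n^{-s} - (n+1)^{-s}` (`n ≥ 1`) are nonnegative and summable with sum
`1`. [folklore] -/
theorem hasSum_rpow_neg_sub {s : ℝ} (hs : 0 < s) :
    HasSum (fun n : ℕ => if n = 0 then (0 : ℝ) else (n : ℝ) ^ (-s) - ((n : ℝ) + 1) ^ (-s)) 1 := by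
  set w : ℕ → ℝ := fun n => if n = 0 then (0 : ℝ) else (n : ℝ) ^ (-s) - ((n : ℝ) + 1) ^ (-s) with hw
  have hw0 : ∀ n, 0 ≤ w n := by
    intro n
    rw [hw]; dsimp only; split_ifs with h
    · exact le_rfl
    · exact (rpow_neg_sub_rpow_neg_bounds (Nat.pos_of_ne_zero h) hs.le).1
  have hpartial : ∀ N : ℕ, ∑ n ∈ Finset.range (N + 1), w n = 1 - ((N : ℝ) + 1) ^ (-s) := by
    intro N
    rw [sum_range_succ_eq_sum_Icc_of_zero w (by simp [hw]) N, ← sum_Icc_rpow_neg_sub s N]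
    refine Finset.sum_congr rfl fun n hn => ?_
    rw [hw]; dsimp only; rw [if_neg (by have := (Finset.mem_Icc.mp hn).1; omega)]
  have htend : Tendsto (fun N : ℕ => ∑ n ∈ Finset.range N, w n) atTop (𝓝 1) := by
    have h1 : Tendsto (fun N : ℕ => 1 - ((N : ℝ) + 1) ^ (-s)) atTop (𝓝 (1 - 0)) := by
      refine tendsto_const_nhds.sub ?_
      have h := (tendsto_rpow_neg_atTop hs).comp
        (tendsto_atTop_add_const_right atTop (1 : ℝ) tendsto_natCast_atTop_atTop)
      exact h
    rw [sub_zero] at h1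
    have h2 : Tendsto (fun N : ℕ => ∑ n ∈ Finset.range (N + 1), w n) atTop (𝓝 1) := by
      simpa only [hpartial] using h1
    exact (tendsto_add_atTop_iff_nat 1).mp h2
  exact (hasSum_iff_tendsto_nat_of_nonneg hw0 1).mpr htend

/-- **Abel's theorem for `∑ a_n n^{-s}` at `s = 0⁺`**: if `|a_n| ≤ B/n`, `a_0 = 0`, and the
partial sums `∑_{n ≤ N} a_n` converge to `A`, then `∑_n a_n n^{-s} → A` as `s → 0⁺`.
(Abel summation: `∑ a_n n^{-s} = ∑_n A_n (n^{-s} - (n+1)^{-s})`, the weights are nonnegative with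
total mass `1`, and each tends to `0`.) [folklore] -/
theorem tendsto_tsum_mul_rpow_neg_of_tendsto_sum {a : ℕ → ℝ} {B A : ℝ} (ha0 : a 0 = 0)
    (ha : ∀ n : ℕ, 1 ≤ n → |a n| ≤ B / n)
    (hA : Tendsto (fun N : ℕ => ∑ n ∈ Icc 1 N, a n) atTop (𝓝 A)) :
    Tendsto (fun s : ℝ => ∑' n : ℕ, a n * (n : ℝ) ^ (-s)) (𝓝[>] 0) (𝓝 A) := by
  set As : ℕ → ℝ := fun N => ∑ n ∈ Icc 1 N, a n with hAs
  have hAs0 : As 0 = 0 := by simp [hAs]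
  -- the weights
  set w : ℝ → ℕ → ℝ := fun s n => if n = 0 then (0 : ℝ) else (n : ℝ) ^ (-s) - ((n : ℝ) + 1) ^ (-s)
    with hw
  have hw0 : ∀ s, 0 < s → ∀ n, 0 ≤ w s n := by
    intro s hs n
    rw [hw]; dsimp only; split_ifs with h
    · exact le_rfl
    · exact (rpow_neg_sub_rpow_neg_bounds (Nat.pos_of_ne_zero h) hs.le).1
  have hwsum : ∀ s, 0 < s → HasSum (w s) 1 := fun s hs => hasSum_rpow_neg_sub hs
  -- boundedness of `As N - A`
  obtain ⟨M, hM⟩ : ∃ M : ℝ, ∀ N, |As N - A| ≤ M := by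
    have h0 : Tendsto (fun N => |As N - A|) atTop (𝓝 |A - A|) := (hA.sub_const A).abs
    obtain ⟨M, hM⟩ := h0.bddAbove_range
    exact ⟨M, fun N => hM ⟨N, rfl⟩⟩
  have hM0 : 0 ≤ M := le_trans (abs_nonneg _) (hM 0)
  -- summability facts for `s > 0`
  have hsw : ∀ s, 0 < s → Summable fun n : ℕ => (As n - A) * w s n := by
    intro s hs
    refine Summable.of_norm_bounded (g := fun n => M * w s n) ((hwsum s hs).summable.mul_left M)
      fun n => ?_
    rw [Real.norm_eq_abs, abs_mul, abs_of_nonneg (hw0 s hs n)]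
    exact mul_le_mul_of_nonneg_right (hM n) (hw0 s hs n)
  have hswA : ∀ s, 0 < s → Summable fun n : ℕ => As n * w s n := by
    intro s hs
    have h := (hsw s hs).add ((hwsum s hs).summable.mul_left A)
    refine h.congr fun n => ?_
    ring
  have hsa : ∀ s : ℝ, 0 < s → Summable fun n : ℕ => a n * (n : ℝ) ^ (-s) := by
    intro s hs
    refine Summable.of_norm_bounded (g := fun n => B * (n : ℝ) ^ (-(1 + s)))
      ((Real.summable_nat_rpow.mpr (by linarith)).mul_left B) fun n => ?_
    rcases Nat.eq_zero_or_pos n with rfl | hn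
    · rw [ha0, zero_mul, norm_zero, Nat.cast_zero, Real.zero_rpow (by linarith), mul_zero]
    · have hn0 : (0 : ℝ) < n := by exact_mod_cast hn
      rw [Real.norm_eq_abs, abs_mul, abs_of_nonneg (Real.rpow_nonneg hn0.le _)]
      calc |a n| * (n : ℝ) ^ (-s) ≤ B / n * (n : ℝ) ^ (-s) :=
            mul_le_mul_of_nonneg_right (ha n hn) (Real.rpow_nonneg hn0.le _)
        _ = B * (n : ℝ) ^ (-(1 + s)) := by
            rw [show (-(1 + s)) = (-1) + (-s) by ring, Real.rpow_add hn0, Real.rpow_neg_one]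
            ring
  -- Step 1: `∑' a_n n^{-s} = A + ∑' (As n - A) w s n` for `s > 0`
  have hrepr : ∀ s : ℝ, 0 < s →
      ∑' n : ℕ, a n * (n : ℝ) ^ (-s) = A + ∑' n : ℕ, (As n - A) * w s n := by
    intro s hs
    -- both sides as limits of the same partial sums
    have hlim1 : Tendsto (fun N : ℕ => ∑ n ∈ Icc 1 N, a n * (n : ℝ) ^ (-s)) atTop
        (𝓝 (∑' n : ℕ, a n * (n : ℝ) ^ (-s))) := by
      have h := ((hsa s hs).hasSum.tendsto_sum_nat).comp (tendsto_add_atTop_nat 1)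
      refine h.congr fun N => ?_
      simp only [Function.comp_def]
      exact sum_range_succ_eq_sum_Icc_of_zero _ (by simp [ha0]) N
    have hAbel : ∀ N : ℕ, ∑ n ∈ Icc 1 N, a n * (n : ℝ) ^ (-s) =
        ∑ n ∈ Icc 1 N, As n * w s n + As N * ((N : ℝ) + 1) ^ (-s) := by
      intro N
      rw [sum_Icc_mul_eq_sum_partial a (fun n => (n : ℝ) ^ (-s)) N]
      push_cast
      congr 1
      refine Finset.sum_congr rfl fun n hn => ?_
      rw [hw]; dsimp only
      rw [if_neg (by have := (Finset.mem_Icc.mp hn).1; omega)]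
    have hlim2 : Tendsto (fun N : ℕ => ∑ n ∈ Icc 1 N, As n * w s n + As N * ((N : ℝ) + 1) ^ (-s))
        atTop (𝓝 (∑' n : ℕ, As n * w s n + A * 0)) := by
      refine Tendsto.add ?_ (hA.mul ?_)
      · have h := ((hswA s hs).hasSum.tendsto_sum_nat).comp (tendsto_add_atTop_nat 1)
        refine h.congr fun N => ?_
        simp only [Function.comp_def]
        exact sum_range_succ_eq_sum_Icc_of_zero _ (by simp [hw]) N
      · exact (tendsto_rpow_neg_atTop hs).comp
          (tendsto_atTop_add_const_right atTop (1 : ℝ) tendsto_natCast_atTop_atTop)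
    rw [mul_zero, add_zero] at hlim2
    have heq : ∑' n : ℕ, a n * (n : ℝ) ^ (-s) = ∑' n : ℕ, As n * w s n :=
      tendsto_nhds_unique hlim1 (by simpa only [hAbel] using hlim2)
    rw [heq]
    have hsplit : ∀ n : ℕ, As n * w s n = A * w s n + (As n - A) * w s n := fun n => by ring
    rw [tsum_congr hsplit, ((hwsum s hs).summable.mul_left A).tsum_add (hsw s hs), tsum_mul_left,
      (hwsum s hs).tsum_eq, mul_one]
  -- Step 2: `∑' (As n - A) w s n → 0` as `s → 0⁺`
  have hsmall : Tendsto (fun s : ℝ => ∑' n : ℕ, (As n - A) * w s n) (𝓝[>] 0) (𝓝 0) := by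
    rw [Metric.tendsto_nhds]
    intro ε hε
    -- choose `N₀` with `|As n - A| < ε/2` beyond
    obtain ⟨N₀, hN₀⟩ : ∃ N₀ : ℕ, ∀ n, N₀ ≤ n → |As n - A| < ε / 2 := by
      have h := Metric.tendsto_atTop.mp hA (ε / 2) (by linarith)
      obtain ⟨N₀, hN₀⟩ := h
      exact ⟨N₀, fun n hn => by have := hN₀ n hn; rwa [Real.dist_eq] at this⟩
    -- the finite part tends to `0`
    have hfin : Tendsto (fun s : ℝ => M * ∑ n ∈ Finset.range N₀, w s n) (𝓝[>] 0) (𝓝 (M * 0)) := by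
      refine Tendsto.const_mul M ?_
      have hsum0 : Tendsto (fun s : ℝ => ∑ n ∈ Finset.range N₀, w s n) (𝓝[>] 0)
          (𝓝 (∑ n ∈ Finset.range N₀, (0 : ℝ))) := by
        refine tendsto_finsetSum _ fun n _ => ?_
        rw [hw]; dsimp only
        split_ifs with hn
        · exact tendsto_const_nhds
        · have hn0 : (n : ℝ) ≠ 0 := by exact_mod_cast hn
          have hn1 : (n : ℝ) + 1 ≠ 0 := by have : (0 : ℝ) ≤ n := Nat.cast_nonneg n; linarith
          have h1 : Tendsto (fun s : ℝ => (n : ℝ) ^ (-s)) (𝓝[>] 0) (𝓝 1) := by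
            have hc := ((Real.continuousAt_const_rpow (b := -(0 : ℝ)) hn0).comp
              (continuous_neg.continuousAt (x := (0 : ℝ)))).tendsto
            simp only [Function.comp_def, neg_zero, Real.rpow_zero] at hc
            exact hc.mono_left nhdsWithin_le_nhds
          have h2 : Tendsto (fun s : ℝ => ((n : ℝ) + 1) ^ (-s)) (𝓝[>] 0) (𝓝 1) := by
            have hc := ((Real.continuousAt_const_rpow (b := -(0 : ℝ)) hn1).comp
              (continuous_neg.continuousAt (x := (0 : ℝ)))).tendsto
            simp only [Function.comp_def, neg_zero, Real.rpow_zero] at hc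
            exact hc.mono_left nhdsWithin_le_nhds
          have := h1.sub h2
          rwa [sub_self] at this
      simpa only [Finset.sum_const_zero] using hsum0
    rw [mul_zero] at hfin
    have hfin' := Metric.tendsto_nhds.mp hfin (ε / 2) (by linarith)
    filter_upwards [hfin', self_mem_nhdsWithin] with s hs1 hs
    have hs0 : 0 < s := hs
    rw [Real.dist_eq, sub_zero] at hs1 ⊢
    -- `|∑'| ≤ ∑' |As n - A| w ≤ M ∑_{n<N₀} w + ε/2 ∑' w`
    have hsabs : Summable fun n : ℕ => |As n - A| * w s n := by
      have := (hsw s hs0).abs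
      refine this.congr fun n => ?_
      rw [abs_mul, abs_of_nonneg (hw0 s hs0 n)]
    have h1 : |∑' n : ℕ, (As n - A) * w s n| ≤ ∑' n : ℕ, |As n - A| * w s n := by
      have := norm_tsum_le_tsum_norm (hsw s hs0).norm
      simp only [Real.norm_eq_abs] at this
      refine this.trans (le_of_eq (tsum_congr fun n => ?_))
      rw [abs_mul, abs_of_nonneg (hw0 s hs0 n)]
    have h2 : ∑' n : ℕ, |As n - A| * w s n =
        ∑ n ∈ Finset.range N₀, |As n - A| * w s n + ∑' n : ℕ, |As (n + N₀) - A| * w s (n + N₀) :=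
      (hsabs.sum_add_tsum_nat_add N₀).symm
    have h3 : ∑ n ∈ Finset.range N₀, |As n - A| * w s n ≤ M * ∑ n ∈ Finset.range N₀, w s n := by
      rw [Finset.mul_sum]
      exact Finset.sum_le_sum fun n _ => mul_le_mul_of_nonneg_right (hM n) (hw0 s hs0 n)
    have h4 : ∑' n : ℕ, |As (n + N₀) - A| * w s (n + N₀) ≤ ε / 2 * ∑' n : ℕ, w s (n + N₀) := by
      rw [← tsum_mul_left]
      refine ((summable_nat_add_iff N₀).mpr hsabs).tsum_le_tsum (fun n => ?_)
        (((summable_nat_add_iff N₀).mpr (hwsum s hs0).summable).mul_left _)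
      exact mul_le_mul_of_nonneg_right (hN₀ _ (by omega)).le (hw0 s hs0 _)
    have h5 : ∑' n : ℕ, w s (n + N₀) ≤ 1 := by
      have h := ((hwsum s hs0).summable.sum_add_tsum_nat_add N₀)
      rw [(hwsum s hs0).tsum_eq] at h
      have : 0 ≤ ∑ n ∈ Finset.range N₀, w s n := Finset.sum_nonneg fun n _ => hw0 s hs0 n
      linarith
    have hfinabs : |M * ∑ n ∈ Finset.range N₀, w s n| < ε / 2 := hs1
    have h6 : M * ∑ n ∈ Finset.range N₀, w s n < ε / 2 := lt_of_le_of_lt (le_abs_self _) hfinabs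
    calc |∑' n : ℕ, (As n - A) * w s n| ≤ ∑' n : ℕ, |As n - A| * w s n := h1
      _ ≤ M * ∑ n ∈ Finset.range N₀, w s n + ε / 2 * ∑' n : ℕ, w s (n + N₀) := by
          rw [h2]; exact add_le_add h3 h4
      _ < ε / 2 + ε / 2 * 1 := by
          have hε2 : 0 ≤ ε / 2 := by linarith
          nlinarith
      _ = ε := by ring
  -- conclusion
  have hfinal : Tendsto (fun s : ℝ => A + ∑' n : ℕ, (As n - A) * w s n) (𝓝[>] 0) (𝓝 (A + 0)) :=
    tendsto_const_nhds.add hsmall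
  rw [add_zero] at hfinal
  refine hfinal.congr' ?_
  filter_upwards [self_mem_nhdsWithin] with s hs
  exact (hrepr s hs).symm

/-! ### Euler products -/

/-- **Summability of `μ(d)g(d)d^{-s}` and its Euler product** (FI (1.14): "the series is also given
by the infinite product"), for `s > 0`: `∑_d |μ(d)g(d)d^{-s}| < ∞`
(`∑^♭_{d ≤ N} g(d)d^{-s} ≤ ∏_{p ≤ N}(1 + g(p)p^{-s}) ≤ exp(K' ∑_n n^{-1-s})`) and
`∏_{p < N} (1 - g(p)p^{-s}) → ∑_d μ(d)g(d)d^{-s}` (Mathlib's `EulerProduct.eulerProduct`).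
[cite: FriedlanderIwaniecASP1998, (1.13)-(1.14)] -/
theorem summable_and_tendsto_prod_moebius_density_rpow {g : ArithmeticFunction ℝ}
    (hg : g.IsMultiplicative) {K : ℝ} (hK : ∀ p : ℕ, p.Prime → 0 ≤ g p ∧ g p < 1 ∧ g p ≤ K / p)
    {s : ℝ} (hs : 0 < s) :
    Summable (fun d : ℕ => ‖(μ d : ℝ) * g d * (d : ℝ) ^ (-s)‖) ∧
      Tendsto (fun N : ℕ => ∏ p ∈ Nat.primesBelow N, (1 - g p * (p : ℝ) ^ (-s))) atTop
        (𝓝 (∑' d : ℕ, (μ d : ℝ) * g d * (d : ℝ) ^ (-s))) := by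
  classical
  set K' := max K 0 with hK'
  have hK'0 : 0 ≤ K' := le_max_right _ _
  have hgK' : ∀ p : ℕ, p.Prime → g p ≤ K' / p := fun p hp =>
    (hK p hp).2.2.trans (div_le_div_of_nonneg_right (le_max_left _ _) (Nat.cast_nonneg _))
  have hg0 : ∀ p : ℕ, p.Prime → 0 ≤ g p := fun p hp => (hK p hp).1
  set f : ℕ → ℝ := fun d => (μ d : ℝ) * g d * (d : ℝ) ^ (-s) with hf
  -- the nonnegative majorant `m d = [d sqfree] g(d) d^{-s}`
  set m : ℕ → ℝ := fun d => if Squarefree d then g d * (d : ℝ) ^ (-s) else 0 with hm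
  have hgsq : ∀ d : ℕ, Squarefree d → 0 ≤ g d := fun d hd => by
    rw [← hg.prod_primeFactors hd]
    exact Finset.prod_nonneg fun p hp => hg0 p (Nat.prime_of_mem_primeFactors hp)
  have hm0 : ∀ d, 0 ≤ m d := fun d => by
    rw [hm]; dsimp only; split_ifs with h
    · exact mul_nonneg (hgsq d h) (Real.rpow_nonneg (Nat.cast_nonneg _) _)
    · exact le_rfl
  have hfm : ∀ d, ‖f d‖ ≤ m d := by
    intro d
    rw [hf, hm]; dsimp only
    by_cases hd : Squarefree d
    · rw [if_pos hd, Real.norm_eq_abs, abs_mul, abs_mul, abs_of_nonneg (hgsq d hd),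
        abs_of_nonneg (Real.rpow_nonneg (Nat.cast_nonneg _) _)]
      have : |(μ d : ℝ)| ≤ 1 := by exact_mod_cast ArithmeticFunction.abs_moebius_le_one
      calc |(μ d : ℝ)| * g d * (d : ℝ) ^ (-s) ≤ 1 * g d * (d : ℝ) ^ (-s) :=
            mul_le_mul_of_nonneg_right (mul_le_mul_of_nonneg_right this (hgsq d hd))
              (Real.rpow_nonneg (Nat.cast_nonneg _) _)
        _ = g d * (d : ℝ) ^ (-s) := by ring
    · rw [if_neg hd, ArithmeticFunction.moebius_eq_zero_of_not_squarefree hd]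
      simp
  -- bounded partial sums of `m`
  set Z : ℝ := ∑' n : ℕ, (n : ℝ) ^ (-(1 + s)) with hZ
  have hZsum : Summable fun n : ℕ => (n : ℝ) ^ (-(1 + s)) := Real.summable_nat_rpow.mpr (by linarith)
  have hpartial : ∀ N : ℕ, ∑ d ∈ Finset.range N, m d ≤ Real.exp (K' * Z) := by
    intro N
    rcases Nat.eq_zero_or_pos N with rfl | hN
    · simp; exact (Real.exp_pos _).le
    obtain ⟨M, rfl⟩ : ∃ M, N = M + 1 := ⟨N - 1, by omega⟩
    rw [sum_range_succ_eq_sum_Icc_of_zero m (by simp [hm]) M]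
    have h1 : ∑ d ∈ Icc 1 M, m d = ∑ d ∈ (Icc 1 M).filter Squarefree, ∏ p ∈ d.primeFactors, g p * (p : ℝ) ^ (-s) := by
      rw [Finset.sum_filter]
      refine Finset.sum_congr rfl fun d _ => ?_
      rw [hm]; dsimp only
      split_ifs with hd
      · rw [Finset.prod_mul_distrib, hg.prod_primeFactors hd,
          Real.finsetProd_rpow _ _ (fun p _ => Nat.cast_nonneg p), ← Nat.cast_prod,
          Nat.prod_primeFactors_of_squarefree hd]
      · rfl
    rw [h1]
    refine (sum_squarefree_prod_primeFactors_le (fun p hp => mul_nonneg (hg0 p hp)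
      (Real.rpow_nonneg (Nat.cast_nonneg _) _)) M).trans ?_
    refine (prod_one_add_le_exp_sum _ fun p hp => mul_nonneg (hg0 p (Nat.prime_of_mem_primesLE hp))
      (Real.rpow_nonneg (Nat.cast_nonneg _) _)).trans (Real.exp_le_exp.mpr ?_)
    calc ∑ p ∈ Nat.primesLE M, g p * (p : ℝ) ^ (-s) ≤ ∑ p ∈ Nat.primesLE M, K' * (p : ℝ) ^ (-(1 + s)) := by
          refine Finset.sum_le_sum fun p hp => ?_
          have hpp := Nat.prime_of_mem_primesLE hp
          have hp0 : (0 : ℝ) < p := by exact_mod_cast hpp.pos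
          calc g p * (p : ℝ) ^ (-s) ≤ K' / p * (p : ℝ) ^ (-s) :=
                mul_le_mul_of_nonneg_right (hgK' p hpp) (Real.rpow_nonneg hp0.le _)
            _ = K' * (p : ℝ) ^ (-(1 + s)) := by
                rw [show (-(1 + s)) = (-1) + (-s) by ring, Real.rpow_add hp0, Real.rpow_neg_one]; ring
      _ = K' * ∑ p ∈ Nat.primesLE M, (p : ℝ) ^ (-(1 + s)) := by rw [Finset.mul_sum]
      _ ≤ K' * Z := by
          refine mul_le_mul_of_nonneg_left ?_ hK'0
          refine (Finset.sum_le_sum_of_subset_of_nonneg (Finset.filter_subset _ _) fun n _ _ =>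
            Real.rpow_nonneg (Nat.cast_nonneg _) _).trans ?_
          exact hZsum.sum_le_tsum _ fun n _ => Real.rpow_nonneg (Nat.cast_nonneg _) _
  have hmsum : Summable m := summable_of_sum_range_le hm0 hpartial
  have hfsum : Summable fun d => ‖f d‖ := Summable.of_nonneg_of_le (fun d => norm_nonneg _) hfm hmsum
  refine ⟨hfsum, ?_⟩
  -- Euler product
  have hf1 : f 1 = 1 := by simp [hf, hg.map_one]
  have hmul : ∀ {a b : ℕ}, Nat.Coprime a b → f (a * b) = f a * f b := by
    intro a b hab
    simp only [hf]
    rw [ArithmeticFunction.isMultiplicative_moebius.map_mul_of_coprime hab, hg.map_mul_of_coprime hab,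
      Nat.cast_mul, Int.cast_mul, Real.mul_rpow (Nat.cast_nonneg _) (Nat.cast_nonneg _)]
    ring
  have hf0 : f 0 = 0 := by simp [hf]
  have h := EulerProduct.eulerProduct hf1 hmul hfsum hf0
  refine (h.congr fun N => Finset.prod_congr rfl fun p hp => ?_)
  have hpp := Nat.prime_of_mem_primesBelow hp
  -- `∑' e, f (p^e) = 1 - g p p^{-s}`
  have hsupp : ∀ e : ℕ, e ∉ ({0, 1} : Finset ℕ) → f (p ^ e) = 0 := by
    intro e he
    simp only [Finset.mem_insert, Finset.mem_singleton, not_or] at he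
    have he2 : 2 ≤ e := by omega
    simp only [hf]
    rw [ArithmeticFunction.moebius_eq_zero_of_not_squarefree, Int.cast_zero, zero_mul, zero_mul]
    intro hsq
    have : p * p ∣ p ^ e := by rw [← sq]; exact pow_dvd_pow p he2
    exact hpp.not_isUnit (hsq p this)
  rw [tsum_eq_sum hsupp, Finset.sum_pair (by norm_num), pow_zero, pow_one, hf1]
  simp only [hf]
  rw [ArithmeticFunction.moebius_apply_prime hpp]
  push_cast
  ring

/-- **The Euler product of `ζ(1+s)`**, real form: `∏_{p<N} (1 - p^{-(1+s)})⁻¹ → ∑_n n^{-(1+s)}`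
(`s > 0`; Mathlib's `eulerProduct_completely_multiplicative`). [folklore] -/
theorem tendsto_prod_one_sub_rpow_inv {s : ℝ} (hs : 0 < s) :
    Tendsto (fun N : ℕ => ∏ p ∈ Nat.primesBelow N, (1 - (p : ℝ) ^ (-(1 + s)))⁻¹) atTop
      (𝓝 (∑' n : ℕ, (n : ℝ) ^ (-(1 + s)))) := by
  set f : ℕ →*₀ ℝ :=
    { toFun := fun n => (n : ℝ) ^ (-(1 + s))
      map_zero' := by
        simp only [Nat.cast_zero]
        exact Real.zero_rpow (by linarith)
      map_one' := by simp
      map_mul' := by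
        intro m n
        simp only [Nat.cast_mul]
        exact Real.mul_rpow (Nat.cast_nonneg _) (Nat.cast_nonneg _) } with hf
  have hsum : Summable fun n => ‖f n‖ := by
    have h : Summable fun n : ℕ => (n : ℝ) ^ (-(1 + s)) := Real.summable_nat_rpow.mpr (by linarith)
    refine h.norm.congr fun n => ?_
    rfl
  exact EulerProduct.eulerProduct_completely_multiplicative hsum

/-- **The pole of `ζ` at `1`**, real form: `s ∑_n n^{-(1+s)} → 1` as `s → 0⁺`
(Mathlib's `tendsto_sub_mul_tsum_nat_rpow`). [folklore] -/
theorem tendsto_mul_tsum_rpow_neg :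
    Tendsto (fun s : ℝ => s * ∑' n : ℕ, (n : ℝ) ^ (-(1 + s))) (𝓝[>] 0) (𝓝 1) := by
  have hmap : Tendsto (fun s : ℝ => 1 + s) (𝓝[>] 0) (𝓝[>] 1) := by
    refine tendsto_nhdsWithin_of_tendsto_nhds_of_eventually_within _ ?_ ?_
    · have : Tendsto (fun s : ℝ => 1 + s) (𝓝 0) (𝓝 (1 + 0)) := tendsto_const_nhds.add tendsto_id
      rw [add_zero] at this
      exact this.mono_left nhdsWithin_le_nhds
    · filter_upwards [self_mem_nhdsWithin] with s hs
      simp only [Set.mem_Ioi] at hs ⊢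
      linarith
  have h := tendsto_sub_mul_tsum_nat_rpow.comp hmap
  refine h.congr fun s => ?_
  simp only [Function.comp_def, add_sub_cancel_left]
  congr 1
  refine tsum_congr fun n => ?_
  rw [one_div, Real.rpow_neg (Nat.cast_nonneg _)]

/-! ### The logarithms of the Euler factors -/

/-- `|log(1 - u) + u| ≤ u²/(1 - u)` for `0 ≤ u < 1` (Mathlib's `abs_log_sub_add_sum_range_le`
with one term). [folklore] -/
theorem abs_log_one_sub_add_le_sq_div {u : ℝ} (hu0 : 0 ≤ u) (hu1 : u < 1) :
    |Real.log (1 - u) + u| ≤ u ^ 2 / (1 - u) := by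
  have h := Real.abs_log_sub_add_sum_range_le (show |u| < 1 by rwa [abs_of_nonneg hu0]) 1
  simp only [Finset.sum_range_one, zero_add, pow_one, abs_of_nonneg hu0] at h
  norm_num at h
  rwa [add_comm] at h

/-- **The Euler factor logarithms decompose as `a_p p^{-s} + O(p^{-2})`**: under (1.8) there is `C_b`
with, for every prime `p` and `s ≥ 0`,
`|log(1 - g(p)p^{-s}) - log(1 - p^{-1-s}) - (1/p - g(p)) p^{-s}| ≤ C_b / p²`
(`= |[log(1-u₁)+u₁] - [log(1-u₂)+u₂]|`, `u₁ = g(p)p^{-s} ≤ g(p) ≤ G < 1`, `u₂ = p^{-1-s} ≤ 1/2`).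
[cite: FriedlanderIwaniecASP1998, (1.8) and (1.14)] -/
theorem exists_bound_log_euler_factors {g : ArithmeticFunction ℝ} {K : ℝ}
    (hK : ∀ p : ℕ, p.Prime → 0 ≤ g p ∧ g p < 1 ∧ g p ≤ K / p) :
    ∃ Cb : ℝ, 0 ≤ Cb ∧ ∀ p : ℕ, p.Prime → ∀ s : ℝ, 0 ≤ s →
      |Real.log (1 - g p * (p : ℝ) ^ (-s)) - Real.log (1 - (p : ℝ) ^ (-(1 + s))) -
          ((p : ℝ)⁻¹ - g p) * (p : ℝ) ^ (-s)| ≤ Cb / (p : ℝ) ^ 2 := by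
  obtain ⟨G, hG1, hG12, hG⟩ := exists_density_le_of_lt_one hK
  set K' := max K 0 with hK'
  have hK'0 : 0 ≤ K' := le_max_right _ _
  have hgK' : ∀ p : ℕ, p.Prime → g p ≤ K' / p := fun p hp =>
    (hK p hp).2.2.trans (div_le_div_of_nonneg_right (le_max_left _ _) (Nat.cast_nonneg _))
  have h1G : 0 < 1 - G := sub_pos.mpr hG1
  refine ⟨K' ^ 2 / (1 - G) + 2, by positivity, ?_⟩
  intro p hp s hs
  have hp2 : (2 : ℝ) ≤ p := by exact_mod_cast hp.two_le
  have hp0 : (0 : ℝ) < p := by linarith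
  have hg0 := (hK p hp).1
  have hg1 := (hK p hp).2.1
  -- the two small quantities
  set u₁ := g p * (p : ℝ) ^ (-s) with hu₁
  set u₂ := (p : ℝ) ^ (-(1 + s)) with hu₂
  have hps : (p : ℝ) ^ (-s) ≤ 1 := Real.rpow_le_one_of_one_le_of_nonpos (by linarith) (by linarith)
  have hps0 : 0 ≤ (p : ℝ) ^ (-s) := Real.rpow_nonneg hp0.le _
  have hu₁0 : 0 ≤ u₁ := mul_nonneg hg0 hps0
  have hu₁g : u₁ ≤ g p := by rw [hu₁]; exact mul_le_of_le_one_right hg0 hps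
  have hu₁1 : u₁ < 1 := lt_of_le_of_lt hu₁g hg1
  have hu₂0 : 0 ≤ u₂ := Real.rpow_nonneg hp0.le _
  have hu₂p : u₂ ≤ (p : ℝ)⁻¹ := by
    rw [hu₂, show (-(1 + s)) = (-1) + (-s) by ring, Real.rpow_add hp0, Real.rpow_neg_one]
    exact mul_le_of_le_one_right (inv_nonneg.mpr hp0.le) hps
  have hpinv : (p : ℝ)⁻¹ ≤ 1 / 2 := by rw [inv_le_comm₀ hp0 (by norm_num)]; linarith
  have hu₂1 : u₂ < 1 := by linarith
  -- the decomposition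
  have hdec : Real.log (1 - u₁) - Real.log (1 - u₂) - ((p : ℝ)⁻¹ - g p) * (p : ℝ) ^ (-s) =
      (Real.log (1 - u₁) + u₁) - (Real.log (1 - u₂) + u₂) := by
    have : ((p : ℝ)⁻¹ - g p) * (p : ℝ) ^ (-s) = u₂ - u₁ := by
      rw [hu₁, hu₂, show (-(1 + s)) = (-1) + (-s) by ring, Real.rpow_add hp0, Real.rpow_neg_one]
      ring
    rw [this]; ring
  rw [hdec]
  have h1 := abs_log_one_sub_add_le_sq_div hu₁0 hu₁1
  have h2 := abs_log_one_sub_add_le_sq_div hu₂0 hu₂1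
  -- `u₁²/(1-u₁) ≤ g(p)²/(1-G) ≤ (K'/p)²/(1-G)`, `u₂²/(1-u₂) ≤ 2 u₂² ≤ 2/p²`
  have hgG := hG p hp
  have h1' : u₁ ^ 2 / (1 - u₁) ≤ K' ^ 2 / (1 - G) / (p : ℝ) ^ 2 := by
    have hKp := hgK' p hp
    have h1G : 0 < 1 - G := by linarith
    calc u₁ ^ 2 / (1 - u₁) ≤ (g p) ^ 2 / (1 - G) := by
          exact div_le_div₀ (sq_nonneg _) (pow_le_pow_left₀ hu₁0 hu₁g 2) h1G (by linarith)
      _ ≤ (K' / p) ^ 2 / (1 - G) := div_le_div_of_nonneg_right (pow_le_pow_left₀ hg0 hKp 2) h1G.le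
      _ = K' ^ 2 / (1 - G) / (p : ℝ) ^ 2 := by field_simp
  have h2' : u₂ ^ 2 / (1 - u₂) ≤ 2 / (p : ℝ) ^ 2 := by
    have hden : (1 : ℝ) / 2 ≤ 1 - u₂ := by linarith
    calc u₂ ^ 2 / (1 - u₂) ≤ ((p : ℝ)⁻¹) ^ 2 / (1 / 2) :=
          div_le_div₀ (sq_nonneg _) (pow_le_pow_left₀ hu₂0 hu₂p 2) (by norm_num) hden
      _ = 2 / (p : ℝ) ^ 2 := by field_simp
  calc |Real.log (1 - u₁) + u₁ - (Real.log (1 - u₂) + u₂)|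
      ≤ |Real.log (1 - u₁) + u₁| + |Real.log (1 - u₂) + u₂| := abs_sub _ _
    _ ≤ K' ^ 2 / (1 - G) / (p : ℝ) ^ 2 + 2 / (p : ℝ) ^ 2 := add_le_add (h1.trans h1') (h2.trans h2')
    _ = (K' ^ 2 / (1 - G) + 2) / (p : ℝ) ^ 2 := by ring

/-- **The Euler factor as an exponential**: for a prime `p`, `s ≥ 0` and `0 ≤ g(p) < 1`,
`exp(log(1 - g(p)p^{-s}) - log(1 - p^{-1-s})) = (1 - g(p)p^{-s}) (1 - p^{-1-s})⁻¹`. [folklore] -/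
theorem exp_log_euler_factor {g : ArithmeticFunction ℝ} {p : ℕ} (hp : p.Prime)
    (hg0 : 0 ≤ g p) (hg1 : g p < 1) {s : ℝ} (hs : 0 ≤ s) :
    Real.exp (Real.log (1 - g p * (p : ℝ) ^ (-s)) - Real.log (1 - (p : ℝ) ^ (-(1 + s)))) =
      (1 - g p * (p : ℝ) ^ (-s)) * (1 - (p : ℝ) ^ (-(1 + s)))⁻¹ := by
  have hp2 : (2 : ℝ) ≤ p := by exact_mod_cast hp.two_le
  have hp0 : (0 : ℝ) < p := by linarith
  have hps : (p : ℝ) ^ (-s) ≤ 1 := Real.rpow_le_one_of_one_le_of_nonpos (by linarith) (by linarith)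
  have h1 : 0 < 1 - g p * (p : ℝ) ^ (-s) := by
    have : g p * (p : ℝ) ^ (-s) ≤ g p := mul_le_of_le_one_right hg0 hps
    linarith
  have h2 : 0 < 1 - (p : ℝ) ^ (-(1 + s)) := by
    have : (p : ℝ) ^ (-(1 + s)) ≤ (p : ℝ)⁻¹ := by
      rw [show (-(1 + s)) = (-1) + (-s) by ring, Real.rpow_add hp0, Real.rpow_neg_one]
      exact mul_le_of_le_one_right (inv_nonneg.mpr hp0.le) hps
    have hpinv : (p : ℝ)⁻¹ ≤ 1 / 2 := by rw [inv_le_comm₀ hp0 (by norm_num)]; linarith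
    linarith
  rw [Real.exp_sub, Real.exp_log h1, Real.exp_log h2, div_eq_mul_inv]

/-- **The Abel transform of a convergent Dirichlet series**: if `a(0) = 0`, the partial sums
`A(N) = ∑_{n ≤ N} a(n)` are bounded and `∑ a(n) n^{-s}` is summable (`s > 0`), then
`∑_n a(n) n^{-s} = ∑_n A(n) (n^{-s} - (n+1)^{-s})` and the latter series is summable. [folklore] -/
theorem tsum_mul_rpow_neg_eq_tsum_partial {a : ℕ → ℝ} (ha0 : a 0 = 0) {M : ℝ}
    (hM : ∀ N : ℕ, |∑ n ∈ Icc 1 N, a n| ≤ M) {s : ℝ} (hs : 0 < s)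
    (hsa : Summable fun n : ℕ => a n * (n : ℝ) ^ (-s)) :
    (Summable fun n : ℕ => (∑ k ∈ Icc 1 n, a k) *
        (if n = 0 then (0 : ℝ) else (n : ℝ) ^ (-s) - ((n : ℝ) + 1) ^ (-s))) ∧
      ∑' n : ℕ, a n * (n : ℝ) ^ (-s) =
        ∑' n : ℕ, (∑ k ∈ Icc 1 n, a k) * (if n = 0 then (0 : ℝ) else (n : ℝ) ^ (-s) - ((n : ℝ) + 1) ^ (-s)) := by
  set As : ℕ → ℝ := fun N => ∑ n ∈ Icc 1 N, a n with hAs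
  set w : ℕ → ℝ := fun n => if n = 0 then (0 : ℝ) else (n : ℝ) ^ (-s) - ((n : ℝ) + 1) ^ (-s) with hw
  have hw0 : ∀ n, 0 ≤ w n := by
    intro n
    rw [hw]; dsimp only; split_ifs with h
    · exact le_rfl
    · exact (rpow_neg_sub_rpow_neg_bounds (Nat.pos_of_ne_zero h) hs.le).1
  have hwsum : HasSum w 1 := hasSum_rpow_neg_sub hs
  have hM0 : 0 ≤ M := le_trans (abs_nonneg _) (hM 0)
  have hswA : Summable fun n : ℕ => As n * w n := by
    refine Summable.of_norm_bounded (g := fun n => M * w n) (hwsum.summable.mul_left M) fun n => ?_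
    rw [Real.norm_eq_abs, abs_mul, abs_of_nonneg (hw0 n)]
    exact mul_le_mul_of_nonneg_right (hM n) (hw0 n)
  refine ⟨hswA, ?_⟩
  have hlim1 : Tendsto (fun N : ℕ => ∑ n ∈ Icc 1 N, a n * (n : ℝ) ^ (-s)) atTop
      (𝓝 (∑' n : ℕ, a n * (n : ℝ) ^ (-s))) := by
    have h := (hsa.hasSum.tendsto_sum_nat).comp (tendsto_add_atTop_nat 1)
    refine h.congr fun N => ?_
    simp only [Function.comp_def]
    exact sum_range_succ_eq_sum_Icc_of_zero _ (by simp [ha0]) N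
  have hAbel : ∀ N : ℕ, ∑ n ∈ Icc 1 N, a n * (n : ℝ) ^ (-s) =
      ∑ n ∈ Icc 1 N, As n * w n + As N * ((N : ℝ) + 1) ^ (-s) := by
    intro N
    rw [sum_Icc_mul_eq_sum_partial a (fun n => (n : ℝ) ^ (-s)) N]
    push_cast
    congr 1
    refine Finset.sum_congr rfl fun n hn => ?_
    rw [hw]; dsimp only
    rw [if_neg (by have := (Finset.mem_Icc.mp hn).1; omega)]
  have hbd : Tendsto (fun N : ℕ => As N * ((N : ℝ) + 1) ^ (-s)) atTop (𝓝 0) := by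
    refine squeeze_zero_norm (f := fun N : ℕ => As N * ((N : ℝ) + 1) ^ (-s)) (t₀ := atTop)
      (a := fun N => M * ((N : ℝ) + 1) ^ (-s)) (fun N => ?_) ?_
    · rw [Real.norm_eq_abs, abs_mul, abs_of_nonneg (Real.rpow_nonneg (by positivity) _)]
      exact mul_le_mul_of_nonneg_right (hM N) (Real.rpow_nonneg (by positivity) _)
    · have h := (tendsto_rpow_neg_atTop hs).comp
        (tendsto_atTop_add_const_right atTop (1 : ℝ) tendsto_natCast_atTop_atTop)
      have := h.const_mul M
      rwa [mul_zero] at this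
  have hlim2 : Tendsto (fun N : ℕ => ∑ n ∈ Icc 1 N, As n * w n + As N * ((N : ℝ) + 1) ^ (-s))
      atTop (𝓝 (∑' n : ℕ, As n * w n + 0)) := by
    refine Tendsto.add ?_ hbd
    have h := (hswA.hasSum.tendsto_sum_nat).comp (tendsto_add_atTop_nat 1)
    refine h.congr fun N => ?_
    simp only [Function.comp_def]
    exact sum_range_succ_eq_sum_Icc_of_zero _ (by simp [hw]) N
  rw [add_zero] at hlim2
  exact tendsto_nhds_unique hlim1 (by simpa only [hAbel] using hlim2)

/-! ### The Euler product identity `Φ(s) ζ(1+s) = exp(∑_p e_p(s))` and its limit -/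

/-- **`Φ(s) ζ(1+s) = exp ∑_p e_p(s)`** for `s > 0`, where `Φ(s) = ∑ μ(d) g(d) d^{-s}`,
`ζ(1+s) = ∑ n^{-1-s}` and `e_p(s) = log(1 - g(p)p^{-s}) - log(1 - p^{-1-s})`: both sides are the
limit of the finite Euler products `∏_{p<N} (1 - g(p)p^{-s})(1 - p^{-1-s})⁻¹`.
[cite: FriedlanderIwaniecASP1998, (1.14)] -/
theorem tsum_moebius_density_rpow_mul_zeta_eq_exp {g : ArithmeticFunction ℝ}
    (hg : g.IsMultiplicative) {K : ℝ} (hK : ∀ p : ℕ, p.Prime → 0 ≤ g p ∧ g p < 1 ∧ g p ≤ K / p)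
    {s : ℝ} (hs : 0 < s)
    (hse : Summable fun n : ℕ => if n.Prime then
      Real.log (1 - g n * (n : ℝ) ^ (-s)) - Real.log (1 - (n : ℝ) ^ (-(1 + s))) else 0) :
    (∑' d : ℕ, (μ d : ℝ) * g d * (d : ℝ) ^ (-s)) * (∑' n : ℕ, (n : ℝ) ^ (-(1 + s))) =
      Real.exp (∑' n : ℕ, if n.Prime then
        Real.log (1 - g n * (n : ℝ) ^ (-s)) - Real.log (1 - (n : ℝ) ^ (-(1 + s))) else 0) := by
  classical
  set e : ℕ → ℝ := fun n => if n.Prime then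
      Real.log (1 - g n * (n : ℝ) ^ (-s)) - Real.log (1 - (n : ℝ) ^ (-(1 + s))) else 0 with he
  have h1 := (summable_and_tendsto_prod_moebius_density_rpow hg hK hs).2.mul
    (tendsto_prod_one_sub_rpow_inv hs)
  have h2 : Tendsto (fun N : ℕ => Real.exp (∑ n ∈ Finset.range N, e n)) atTop
      (𝓝 (Real.exp (∑' n : ℕ, e n))) :=
    (Real.continuous_exp.tendsto _).comp hse.hasSum.tendsto_sum_nat
  refine tendsto_nhds_unique (h1.congr fun N => ?_) h2
  rw [← Finset.prod_mul_distrib, Nat.primesBelow, Finset.prod_filter, Real.exp_sum]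
  refine Finset.prod_congr rfl fun p _ => ?_
  rw [he]; dsimp only
  split_ifs with hp
  · exact (exp_log_euler_factor hp (hK p hp).1 (hK p hp).2.1 hs.le).symm
  · rw [Real.exp_zero]

/-- **`∑_p e_p(s) → log H` as `s → 0+`.** Write `e_p(s) = a_p p^{-s} + b_p(s)` with
`a_p = 1/p - g(p)` and `|b_p(s)| ≤ C_b p^{-2}` (`exists_bound_log_euler_factors`). The `b`-part is
continuous at `s = 0` by dominated convergence; `∑_{p ≤ N} a_p = log P_N - ∑_{p ≤ N} b_p(0)` converges
(to `log H - ∑_p b_p(0)`) because the partial products `P_N → H > 0`, so the `a`-part tends to the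
same limit by Abel's limit theorem for Dirichlet series (`tendsto_tsum_mul_rpow_neg_of_tendsto_sum`).
[cite: FriedlanderIwaniecASP1998, (1.13)-(1.14)] -/
theorem tendsto_tsum_log_euler_factors {g : ArithmeticFunction ℝ}
    {K : ℝ} (hK : ∀ p : ℕ, p.Prime → 0 ≤ g p ∧ g p < 1 ∧ g p ≤ K / p) {H : ℝ} (hH0 : 0 < H)
    (hH : Tendsto (fun x : ℕ => ∏ p ∈ Nat.primesLE x, (1 - g p) / (1 - (p : ℝ)⁻¹)) atTop (𝓝 H)) :
    (∀ s : ℝ, 0 < s → Summable fun n : ℕ => if n.Prime then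
      Real.log (1 - g n * (n : ℝ) ^ (-s)) - Real.log (1 - (n : ℝ) ^ (-(1 + s))) else 0) ∧
    Tendsto (fun s : ℝ => ∑' n : ℕ, if n.Prime then
        Real.log (1 - g n * (n : ℝ) ^ (-s)) - Real.log (1 - (n : ℝ) ^ (-(1 + s))) else 0)
      (𝓝[>] 0) (𝓝 (Real.log H)) := by
  classical
  obtain ⟨Cb, hCb0, hCb⟩ := exists_bound_log_euler_factors hK
  set K' := max K 0 with hK'
  have hK'0 : 0 ≤ K' := le_max_right _ _
  have hgK' : ∀ p : ℕ, p.Prime → g p ≤ K' / p := fun p hp =>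
    (hK p hp).2.2.trans (div_le_div_of_nonneg_right (le_max_left _ _) (Nat.cast_nonneg _))
  -- the three families
  set e : ℝ → ℕ → ℝ := fun s n => if n.Prime then
      Real.log (1 - g n * (n : ℝ) ^ (-s)) - Real.log (1 - (n : ℝ) ^ (-(1 + s))) else 0 with he
  set a : ℕ → ℝ := fun n => if n.Prime then (n : ℝ)⁻¹ - g n else 0 with ha
  set b : ℝ → ℕ → ℝ := fun s n => if n.Prime then
      Real.log (1 - g n * (n : ℝ) ^ (-s)) - Real.log (1 - (n : ℝ) ^ (-(1 + s))) -
        ((n : ℝ)⁻¹ - g n) * (n : ℝ) ^ (-s) else 0 with hb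
  have heab : ∀ s n, e s n = a n * (n : ℝ) ^ (-s) + b s n := by
    intro s n
    rw [he, ha, hb]; dsimp only
    split_ifs with hp
    · ring
    · simp
  have ha0 : a 0 = 0 := by rw [ha]; dsimp only; rw [if_neg Nat.not_prime_zero]
  have hb0 : ∀ s, b s 0 = 0 := by intro s; rw [hb]; dsimp only; rw [if_neg Nat.not_prime_zero]
  have he0 : ∀ s, e s 0 = 0 := by intro s; rw [he]; dsimp only; rw [if_neg Nat.not_prime_zero]
  -- bounds
  have hbbd : ∀ s : ℝ, 0 ≤ s → ∀ n : ℕ, |b s n| ≤ Cb / (n : ℝ) ^ 2 := by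
    intro s hs n
    rw [hb]; dsimp only
    split_ifs with hp
    · exact hCb n hp s hs
    · rw [abs_zero]; positivity
  have habd : ∀ n : ℕ, 1 ≤ n → |a n| ≤ (1 + K') / n := by
    intro n hn
    rw [ha]; dsimp only
    split_ifs with hp
    · have hn0 : (0 : ℝ) < n := by exact_mod_cast hn
      have hg0 := (hK n hp).1
      calc |(n : ℝ)⁻¹ - g n| ≤ |(n : ℝ)⁻¹| + |g n| := abs_sub _ _
        _ = (n : ℝ)⁻¹ + g n := by rw [abs_of_pos (inv_pos.mpr hn0), abs_of_nonneg hg0]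
        _ ≤ 1 / n + K' / n := add_le_add (by rw [one_div]) (hgK' n hp)
        _ = (1 + K') / n := by ring
    · rw [abs_zero]; positivity
  have hbsum0 : Summable fun n : ℕ => Cb / (n : ℝ) ^ 2 := by
    have := (Real.summable_one_div_nat_pow.mpr one_lt_two).mul_left Cb
    simpa only [mul_one_div] using this
  have hbsum : ∀ s : ℝ, 0 ≤ s → Summable (b s) := fun s hs =>
    Summable.of_norm_bounded hbsum0 fun n => by rw [Real.norm_eq_abs]; exact hbbd s hs n
  have hasum : ∀ s : ℝ, 0 < s → Summable fun n : ℕ => a n * (n : ℝ) ^ (-s) := by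
    intro s hs
    refine Summable.of_norm_bounded (g := fun n : ℕ => (1 + K') * (n : ℝ) ^ (-(1 + s)))
      ((Real.summable_nat_rpow.mpr (by linarith)).mul_left _) fun n => ?_
    rw [Real.norm_eq_abs]
    rcases Nat.eq_zero_or_pos n with rfl | hn
    · rw [ha0, zero_mul, abs_zero]
      exact mul_nonneg (by linarith) (Real.rpow_nonneg (Nat.cast_nonneg _) _)
    · have hn0 : (0 : ℝ) < n := by exact_mod_cast hn
      rw [abs_mul, abs_of_nonneg (Real.rpow_nonneg hn0.le _),
        show (-(1 + s)) = (-1) + (-s) by ring, Real.rpow_add hn0, Real.rpow_neg_one, ← mul_assoc,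
        ← div_eq_mul_inv]
      exact mul_le_mul_of_nonneg_right (habd n hn) (Real.rpow_nonneg hn0.le _)
  have hesum : ∀ s : ℝ, 0 < s → Summable (e s) := by
    intro s hs
    have := (hasum s hs).add (hbsum s hs.le)
    refine this.congr fun n => (heab s n).symm
  refine ⟨hesum, ?_⟩
  -- (1) the `b`-part is continuous at `0+`
  have hb_lim : Tendsto (fun s : ℝ => ∑' n : ℕ, b s n) (𝓝[>] 0) (𝓝 (∑' n : ℕ, b 0 n)) := by
    refine tendsto_tsum_of_dominated_convergence hbsum0 (fun n => ?_) ?_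
    · rw [hb]; dsimp only
      by_cases hp : n.Prime
      · simp only [if_pos hp]
        have hn2 : (2 : ℝ) ≤ n := by exact_mod_cast hp.two_le
        have hn0 : (0 : ℝ) < n := by linarith
        have hr1 : Continuous fun s : ℝ => (n : ℝ) ^ (-s) :=
          continuous_const.rpow continuous_neg fun _ => Or.inl hn0.ne'
        have hr2 : Continuous fun s : ℝ => (n : ℝ) ^ (-(1 + s)) :=
          continuous_const.rpow (continuous_const.add continuous_id).neg fun _ => Or.inl hn0.ne'
        have hl1 : ContinuousAt (fun s : ℝ => Real.log (1 - g n * (n : ℝ) ^ (-s))) 0 := by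
          refine ContinuousAt.log (continuous_const.sub (continuous_const.mul hr1)).continuousAt ?_
          simp only [neg_zero, Real.rpow_zero, mul_one]
          linarith [(hK n hp).2.1]
        have hl2 : ContinuousAt (fun s : ℝ => Real.log (1 - (n : ℝ) ^ (-(1 + s)))) 0 := by
          refine ContinuousAt.log (continuous_const.sub hr2).continuousAt ?_
          simp only [add_zero, Real.rpow_neg_one]
          have : (n : ℝ)⁻¹ ≤ 1 / 2 := by rw [inv_le_comm₀ hn0 (by norm_num)]; linarith
          linarith
        have h := ((hl1.sub hl2).sub
          (((continuous_const (y := (n : ℝ)⁻¹ - g n)).mul hr1).continuousAt (x := (0 : ℝ)))).tendsto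
        exact h.mono_left nhdsWithin_le_nhds
      · simp only [if_neg hp]
        exact tendsto_const_nhds
    · filter_upwards [self_mem_nhdsWithin] with s hs
      intro n
      rw [Real.norm_eq_abs]
      exact hbbd s (le_of_lt hs) n
  -- (2) the partial sums of `a` converge to `log H - ∑ b_p(0)`
  have hPpos : ∀ N : ℕ, ∀ p ∈ Nat.primesLE N, 0 < (1 - g p) / (1 - (p : ℝ)⁻¹) := by
    intro N p hp
    have hp' := Nat.prime_of_mem_primesBelow hp
    have hp2 : (2 : ℝ) ≤ p := by exact_mod_cast hp'.two_le
    have hp0 : (0 : ℝ) < p := by linarith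
    have : (p : ℝ)⁻¹ ≤ 1 / 2 := by rw [inv_le_comm₀ hp0 (by norm_num)]; linarith
    exact div_pos (by linarith [(hK p hp').2.1]) (by linarith)
  have hlogP : ∀ N : ℕ, Real.log (∏ p ∈ Nat.primesLE N, (1 - g p) / (1 - (p : ℝ)⁻¹)) =
      ∑ n ∈ Icc 1 N, e 0 n := by
    intro N
    rw [Real.log_prod fun p hp => (hPpos N p hp).ne', Nat.primesLE, Nat.primesBelow,
      Finset.sum_filter, sum_range_succ_eq_sum_Icc_of_zero _ (by rw [if_neg Nat.not_prime_zero])]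
    refine Finset.sum_congr rfl fun n hn => ?_
    rw [he]; dsimp only
    split_ifs with hp
    · have hn2 : (2 : ℝ) ≤ n := by exact_mod_cast hp.two_le
      have hn0 : (0 : ℝ) < n := by linarith
      have : (n : ℝ)⁻¹ ≤ 1 / 2 := by rw [inv_le_comm₀ hn0 (by norm_num)]; linarith
      rw [neg_zero, Real.rpow_zero, mul_one, add_zero, Real.rpow_neg_one,
        Real.log_div (by linarith [(hK n hp).2.1]) (by linarith)]
    · rfl
  have hA : Tendsto (fun N : ℕ => ∑ n ∈ Icc 1 N, a n) atTop
      (𝓝 (Real.log H - ∑' n : ℕ, b 0 n)) := by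
    have h1 : Tendsto (fun N : ℕ => Real.log (∏ p ∈ Nat.primesLE N, (1 - g p) / (1 - (p : ℝ)⁻¹)))
        atTop (𝓝 (Real.log H)) := ((Real.continuousAt_log hH0.ne').tendsto).comp hH
    have h2 : Tendsto (fun N : ℕ => ∑ n ∈ Icc 1 N, b 0 n) atTop (𝓝 (∑' n : ℕ, b 0 n)) := by
      have h := ((hbsum 0 le_rfl).hasSum.tendsto_sum_nat).comp (tendsto_add_atTop_nat 1)
      refine h.congr fun N => ?_
      simp only [Function.comp_def]
      exact sum_range_succ_eq_sum_Icc_of_zero _ (hb0 0) N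
    have h3 := h1.sub h2
    refine h3.congr fun N => ?_
    rw [hlogP N, sub_eq_iff_eq_add, ← Finset.sum_add_distrib]
    refine Finset.sum_congr rfl fun n _ => ?_
    rw [heab 0 n, neg_zero, Real.rpow_zero, mul_one]
  -- (3) Abel's limit theorem for the `a`-part
  have ha_lim := tendsto_tsum_mul_rpow_neg_of_tendsto_sum ha0 habd hA
  -- (4) add up
  have h := ha_lim.add hb_lim
  rw [sub_add_cancel] at h
  refine h.congr' ?_
  filter_upwards [self_mem_nhdsWithin] with s hs
  rw [← (hasum s hs).tsum_add (hbsum s hs.le)]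
  exact tsum_congr fun n => (heab s n).symm

/-! ### (1.13)–(1.14) from (2.4) -/

/-- **FI (1.13)–(1.14) from (2.4)**: the named fact `fi_moebius_density_log_sum`
(`∑_{b ≤ N} μ(b) g(b) log b → -H`) follows from the named fact `fi_moebius_density_cancellation`
(FI (2.4), used with `ν = 1`).

Proof. Let `c(d) = μ(d) g(d)`, `C(N) = ∑_{d ≤ N} c(d)`, so `|C(N)| ≤ K (log N)^{-6}` by (2.4). By Abel
summation `∑_{b ≤ N} c(b) log b → -W` with `W = ∑_d C(d) log((d+1)/d)`
(`tendsto_sum_mul_log_of_partial_bound`), and it remains to show `W = H`. For `s > 0` put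
`Φ(s) = ∑_d c(d) d^{-s} = ∑_d C(d)(d^{-s} - (d+1)^{-s})`; then `Φ(s)/s → W` as `s → 0+` by dominated
convergence (`tendsto_tsum_partial_mul_rpow_diff_div`). On the other hand
`Φ(s) ζ(1+s) = exp(∑_p e_p(s)) → exp(log H) = H` (`tsum_moebius_density_rpow_mul_zeta_eq_exp`,
`tendsto_tsum_log_euler_factors`) and `s ζ(1+s) → 1`, so `Φ(s)/s → H`; hence `W = H`.
[cite: FriedlanderIwaniecASP1998, (1.12)-(1.14) and (2.4)] -/
theorem fi_moebius_density_log_sum_of_cancellation (h24 : fi_moebius_density_cancellation) :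
    fi_moebius_density_log_sum := by
  intro g hg h18 h19 H hH
  classical
  obtain ⟨K, hK⟩ := h18
  have hH0 : 0 < H := fi_densityConstant_pos_holds g hg ⟨K, hK⟩ h19 H hH
  obtain ⟨K₂₄, h24'⟩ := h24 g hg ⟨K, hK⟩ h19
  -- the coefficients and their partial sums
  set c : ℕ → ℝ := fun d => (μ d : ℝ) * g d with hc
  set C : ℕ → ℝ := fun d => ∑ j ∈ Icc 1 d, c j with hCdef
  have hc0 : c 0 = 0 := by simp [hc]
  have hC0 : C 0 = 0 := by simp [hCdef]
  have hC1 : C 1 = 1 := by simp [hCdef, hc, hg.map_one]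
  set K₆ := max (K₂₄ * sigmaHalf 1) 0 with hK₆
  have hK₆0 : 0 ≤ K₆ := le_max_right _ _
  have hC : ∀ d : ℕ, 2 ≤ d → |C d| ≤ K₆ / Real.log d ^ 6 := by
    intro d hd
    have hd2 : (2 : ℝ) ≤ d := by exact_mod_cast hd
    have h := h24' 1 le_rfl d hd2
    rw [Nat.floor_natCast, Finset.filter_true_of_mem fun x _ => Nat.coprime_one_right x] at h
    refine h.trans (div_le_div_of_nonneg_right (le_max_left _ _)
      (pow_nonneg (Real.log_nonneg (by linarith)) _))
  -- Abel summation: `V_N → -W`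
  have hV := tendsto_sum_mul_log_of_partial_bound hK₆0 hC
  suffices hW : ∑' d : ℕ, C d * (Real.log ((d : ℝ) + 1) - Real.log d) = H by
    rw [← hW]; exact hV
  -- `Φ(s)/s → W`
  have hM : ∀ N : ℕ, |C N| ≤ K₆ / Real.log 2 ^ 6 + 1 := by
    intro N
    have hl2 : 0 < Real.log 2 := Real.log_pos one_lt_two
    rcases Nat.lt_or_ge N 2 with hN | hN
    · interval_cases N
      · rw [hC0, abs_zero]; positivity
      · rw [hC1, abs_one]; linarith [show 0 ≤ K₆ / Real.log 2 ^ 6 by positivity]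
    · have hN2 : (2 : ℝ) ≤ N := by exact_mod_cast hN
      calc |C N| ≤ K₆ / Real.log N ^ 6 := hC N hN
        _ ≤ K₆ / Real.log 2 ^ 6 :=
          div_le_div_of_nonneg_left hK₆0 (by positivity)
            (pow_le_pow_left₀ hl2.le (Real.log_le_log two_pos hN2) 6)
        _ ≤ K₆ / Real.log 2 ^ 6 + 1 := by linarith
  have hΦ : ∀ s : ℝ, 0 < s → (∑' d : ℕ, c d * (d : ℝ) ^ (-s)) / s =
      ∑' d : ℕ, C d * (((d : ℝ) ^ (-s) - ((d : ℝ) + 1) ^ (-s)) / s) := by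
    intro s hs
    have hsa : Summable fun d : ℕ => c d * (d : ℝ) ^ (-s) :=
      (summable_and_tendsto_prod_moebius_density_rpow hg hK hs).1.of_norm
    rw [(tsum_mul_rpow_neg_eq_tsum_partial hc0 hM hs hsa).2, ← tsum_div_const]
    refine tsum_congr fun d => ?_
    rcases Nat.eq_zero_or_pos d with rfl | hd
    · simp [hC0]
    · rw [if_neg hd.ne', mul_div_assoc]
  have hlimW : Tendsto (fun s : ℝ => (∑' d : ℕ, c d * (d : ℝ) ^ (-s)) / s) (𝓝[>] 0)
      (𝓝 (∑' d : ℕ, C d * (Real.log ((d : ℝ) + 1) - Real.log d))) := by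
    refine (tendsto_tsum_partial_mul_rpow_diff_div hC0 hK₆0 hC).congr' ?_
    filter_upwards [self_mem_nhdsWithin] with s hs
    exact (hΦ s hs).symm
  -- `Φ(s)/s → H`
  obtain ⟨hesum, helim⟩ := tendsto_tsum_log_euler_factors hK hH0 hH
  have hZpos : ∀ s : ℝ, 0 < s → 0 < ∑' n : ℕ, (n : ℝ) ^ (-(1 + s)) := by
    intro s hs
    refine (Real.summable_nat_rpow.mpr (by linarith)).tsum_pos
      (fun n => Real.rpow_nonneg (Nat.cast_nonneg _) _) 1 ?_
    rw [Nat.cast_one, Real.one_rpow]; exact one_pos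
  have hlimH : Tendsto (fun s : ℝ => (∑' d : ℕ, c d * (d : ℝ) ^ (-s)) / s) (𝓝[>] 0) (𝓝 H) := by
    have h1 := ((Real.continuous_exp.tendsto _).comp helim).div tendsto_mul_tsum_rpow_neg one_ne_zero
    rw [Real.exp_log hH0, div_one] at h1
    refine h1.congr' ?_
    filter_upwards [self_mem_nhdsWithin] with s hs
    have hZ := hZpos s hs
    rw [Pi.div_apply, Function.comp_apply,
      ← tsum_moebius_density_rpow_mul_zeta_eq_exp hg hK hs (hesum s hs), mul_div_mul_right _ _ hZ.ne']
  exact tendsto_nhds_unique hlimW hlimH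

end Literature.NumberTheory.Sieve
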